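import Literature.NumberTheory.Automorphic.HarishChandraGLExistence
import Literature.NumberTheory.Automorphic.ArchParameterSplitCentre
import Literature.Algebra.Lie.CasimirElement
import HarnessLib

/-!
# The two real Casimir elements of `𝔤𝔩₂(ℂ)` (as a REAL Lie algebra) and their scalars on modules
# of Harish-Chandra parameter `({u₁, u₂}, {v₁, v₂})` (Knapp 2002, §V.4–V.5, Thm. 5.44)

Topic `NumberTheory/Automorphic`; the complex-place companion of `GL2CasimirScalar` (which treats
`𝔤𝔩₂(ℝ)`). The tree reads the archimedean component of an automorphic representation of `GL₂`
at a complex place `w` only through `HasHCParameter (𝕜 := ℂ) ρ χ` for the REAL Lie algebra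
representation `ρ` of `𝔤𝔩₂(ℂ) = 𝔤𝔩₂(K_w)` (`ArchimedeanGLn.HasArchParameter`): the centre of the
real enveloping algebra `U = U_ℝ(𝔤𝔩₂(ℂ))` acts through `z ↦ γ(z)(x)`, `x τ = χ τ` for the two real
algebra embeddings `τ ∈ {id, conj} = (ℂ →ₐ[ℝ] ℂ)` (`U_ℂ = U(𝔤𝔩₂) ⊗ U(𝔤𝔩₂)`, one factor per `τ`).
To use this on vectors one needs explicit central elements of `U` and their Harish-Chandra
polynomials. Degree one is in the tree (`HasHCParameter.apply_one`, `apply_smul_one`: `ρ(1)`,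
`ρ(i·1)`). This file supplies degree two:

* `GL2ComplexCasimir.gen⟪a, b⟫ : ℂ →ₗ[ℝ] U`, `x ↦ ι(x E_{ab})`; `gen_comm` (the commutation
  relations); `ιU_eq_sum_gen`.
* `GL2ComplexCasimir.pairCasimir u u' ε = ∑_s ε_s ∑_{a,b} ι(u_s E_{ab}) ι(u'_s E_{ba})` and
  `pairCasimir_mem_center` — **central as soon as `∑_s ε_s (x u_s) ⊗ u'_s = ∑_s ε_s u_s ⊗ (u'_s x)`**
  (the argument of `RealCasimirGL.casimirU_mem_center`, Knapp 2002 §V.4, run for a pair of unit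
  families); the two instances
  `casimirRe = ∑_{a,b} (ι(E_{ab})ι(E_{ba}) - ι(iE_{ab})ι(iE_{ba}))` (`= 2(C_id + C_conj)` in `U_ℂ`) and
  `casimirIm = ∑_{a,b} (ι(iE_{ab})ι(E_{ba}) + ι(E_{ab})ι(iE_{ba}))` (`= 2i(C_id - C_conj)`), both
  central (`casimirRe_mem_center`, `casimirIm_mem_center`).

The sequel `GL2ComplexCasimirScalar` evaluates both on highest weight vectors, computes their
Harish-Chandra polynomials `2 ∑_τ (x_{τ,0}² + x_{τ,1}² - ½)` and `2i((x_{id,0}² + x_{id,1}² - ½) -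
(x_{conj,0}² + x_{conj,1}² - ½))`, and deduces the scalars `2(c_u + c_v)`, `2i(c_u - c_v)`
(`c_u = u₁² + u₂² - ½`, `c_v = v₁² + v₂² - ½`) by which they act on a module of Harish-Chandra
parameter `({u₁, u₂}, {v₁, v₂})`. Everything here is proved; the definitions are the generators and
the central elements.

## References

* A. W. Knapp, *Lie Groups Beyond an Introduction*, 2nd ed. (2002), §V.4 (Casimir element),
  §V.5 (Lemma 5.42, (5.43), Thm. 5.44), §VI.1 (complexification) [Knapp2002].
* L. Clozel, *Motifs et formes automorphes* (1990), §3.3 [Clozel1990].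
-/

noncomputable section

-- Mathlib idiom (Mathlib/Algebra/Lie/OfAssociative.lean); commutator brackets on matrices and endomorphisms
attribute [local instance 100] LieRing.ofAssociativeRing

open scoped Matrix ComplexConjugate
open UniversalEnvelopingAlgebra

namespace Literature.NumberTheory.Automorphic

namespace GL2ComplexCasimir

open HCSpan

/-! ### Generators of `U_ℝ(𝔤𝔩₂(ℂ))` and their commutation relations -/

/-- Notation (local to this file): `gen⟪a, b⟫` is the real-linear generator map
`x ↦ ι(x E_{ab}) : ℂ →ₗ[ℝ] U_ℝ(𝔤𝔩₂(ℂ))` (no new definition: `ι ∘ Matrix.singleLinearMap`). -/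
local notation "gen⟪" a ", " b "⟫" =>
  (LinearMap.comp (LieHom.toLinearMap (ιU : Matrix (Fin 2) (Fin 2) ℂ →ₗ⁅ℝ⁆ UGL ℂ 2))
    (Matrix.singleLinearMap ℝ a b))

/-- `gen⟪a, b⟫ x = ι(x E_{ab})`. [folklore] -/
theorem gen_apply (a b : Fin 2) (x : ℂ) : gen⟪a, b⟫ x = ιU (Matrix.single a b x) := rfl

/-- The commutation relation of two generators:
`ι(xE_{cd}) ι(yE_{ab}) - ι(yE_{ab}) ι(xE_{cd}) = δ_{da} ι((xy)E_{cb}) - δ_{bc} ι((yx)E_{ad})`. [folklore] -/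
theorem gen_comm (c d a b : Fin 2) (x y : ℂ) :
    gen⟪c, d⟫ x * gen⟪a, b⟫ y - gen⟪a, b⟫ y * gen⟪c, d⟫ x =
      (if d = a then gen⟪c, b⟫ (x * y) else 0) - (if b = c then gen⟪a, d⟫ (y * x) else 0) := by
  simp only [gen_apply]
  rw [← LieRing.of_associative_ring_bracket, ← LieHom.map_lie, single_lie_single, map_sub]
  congr 1
  · split_ifs
    · rfl
    · rw [Matrix.single_zero, map_zero]
  · split_ifs
    · rfl
    · rw [Matrix.single_zero, map_zero]

/-- `ι(Y) = ∑_{a,b} ι(Y_{ab} E_{ab})`. [folklore] -/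
theorem ιU_eq_sum_gen (Y : Matrix (Fin 2) (Fin 2) ℂ) : ιU Y = ∑ a, ∑ b, gen⟪a, b⟫ (Y a b) := by
  conv_lhs => rw [Matrix.matrix_eq_sum_single Y]
  simp only [map_sum, gen_apply]

/-! ### Pair Casimir elements and their centrality -/

/-- Notation (local): the **pair Casimir element** `∑_s ε_s ∑_{a,b} ι(u_s E_{ab}) ι(u'_s E_{ba})`
of `U_ℝ(𝔤𝔩₂(ℂ))` attached to two families of scalars `u, u' : S → ℂ` and signs `ε : S → ℝ`
(Knapp 2002, §V.4; no new definition). -/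
local notation "pairCasimir⟪" u ", " u' ", " ε "⟫" =>
  (∑ s, ε s • ∑ a : Fin 2, ∑ b : Fin 2,
    ιU (Matrix.single a b (u s)) * ιU (Matrix.single b a (u' s)) : UGL ℂ 2)

/-- The commutator of a generator `g = ι(x E_{cd})` with one summand `∑_{a,b} ι(u E_{ab}) ι(u' E_{ba})`:
four single sums (as in `RealCasimirGL.genU_comm_sum_sq`). [folklore] -/
theorem gen_comm_sum_pair (c d : Fin 2) (x u u' : ℂ) :
    gen⟪c, d⟫ x * (∑ a : Fin 2, ∑ b : Fin 2, gen⟪a, b⟫ u * gen⟪b, a⟫ u') -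
        (∑ a : Fin 2, ∑ b : Fin 2, gen⟪a, b⟫ u * gen⟪b, a⟫ u') * gen⟪c, d⟫ x =
      (∑ b, gen⟪c, b⟫ (x * u) * gen⟪b, d⟫ u' - ∑ b, gen⟪c, b⟫ u * gen⟪b, d⟫ (u' * x)) +
        (∑ a, gen⟪a, d⟫ u * gen⟪c, a⟫ (x * u') - ∑ a, gen⟪a, d⟫ (u * x) * gen⟪c, a⟫ u') := by
  have hcomm : ∀ P Q : UGL ℂ 2, gen⟪c, d⟫ x * (P * Q) - (P * Q) * gen⟪c, d⟫ x =
      (gen⟪c, d⟫ x * P - P * gen⟪c, d⟫ x) * Q + P * (gen⟪c, d⟫ x * Q - Q * gen⟪c, d⟫ x) :=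
    fun P Q ↦ by noncomm_ring
  rw [Finset.mul_sum, Finset.sum_mul, ← Finset.sum_sub_distrib]
  simp_rw [Finset.mul_sum, Finset.sum_mul, ← Finset.sum_sub_distrib, hcomm, gen_comm,
    sub_mul, mul_sub, ite_mul, mul_ite, zero_mul, mul_zero, Finset.sum_add_distrib,
    Finset.sum_sub_distrib]
  have e1 : ∑ a, ∑ b, (if d = a then gen⟪c, b⟫ (x * u) * gen⟪b, a⟫ u' else 0) =
      ∑ b, gen⟪c, b⟫ (x * u) * gen⟪b, d⟫ u' := by
    rw [Finset.sum_comm]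
    simp_rw [Finset.sum_ite_eq, Finset.mem_univ, if_true]
  have e2 : ∑ a, ∑ b, (if b = c then gen⟪a, d⟫ (u * x) * gen⟪b, a⟫ u' else 0) =
      ∑ a, gen⟪a, d⟫ (u * x) * gen⟪c, a⟫ u' := by
    simp_rw [Finset.sum_ite_eq', Finset.mem_univ, if_true]
  have e3 : ∑ a, ∑ b, (if d = b then gen⟪a, b⟫ u * gen⟪c, a⟫ (x * u') else 0) =
      ∑ a, gen⟪a, d⟫ u * gen⟪c, a⟫ (x * u') := by
    simp_rw [Finset.sum_ite_eq, Finset.mem_univ, if_true]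
  have e4 : ∑ a, ∑ b, (if a = c then gen⟪a, b⟫ u * gen⟪b, d⟫ (u' * x) else 0) =
      ∑ b, gen⟪c, b⟫ u * gen⟪b, d⟫ (u' * x) := by
    rw [Finset.sum_comm]
    simp_rw [Finset.sum_ite_eq', Finset.mem_univ, if_true]
  rw [e1, e2, e3, e4]
  abel

/-- **A pair Casimir element commutes with every generator** as soon as the twisted Frobenius identity
`∑_s ε_s β(x u_s, u'_s) = ∑_s ε_s β(u_s, u'_s x)` holds for all real bilinear `β` (the four sums of
`gen_comm_sum_pair` cancel in pairs). Knapp 2002, §V.4. [cite: Knapp2002, §V.4] -/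
theorem gen_mul_pairCasimir {S : Type*} [Fintype S] (u u' : S → ℂ) (ε : S → ℝ)
    (hF : ∀ (β : ℂ →ₗ[ℝ] ℂ →ₗ[ℝ] UGL ℂ 2) (x : ℂ),
      ∑ s, ε s • β (x * u s) (u' s) = ∑ s, ε s • β (u s) (u' s * x))
    (c d : Fin 2) (x : ℂ) :
    gen⟪c, d⟫ x * pairCasimir⟪u, u', ε⟫ = pairCasimir⟪u, u', ε⟫ * gen⟪c, d⟫ x := by
  simp only [← gen_apply]
  rw [← sub_eq_zero, Finset.mul_sum, Finset.sum_mul, ← Finset.sum_sub_distrib]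
  simp_rw [mul_smul_comm, smul_mul_assoc, ← smul_sub, gen_comm_sum_pair, smul_add, smul_sub,
    Finset.sum_add_distrib, Finset.sum_sub_distrib, Finset.smul_sum]
  rw [Finset.sum_comm (f := fun s b ↦ ε s • (gen⟪c, b⟫ (x * u s) * gen⟪b, d⟫ (u' s))),
    Finset.sum_comm (f := fun s b ↦ ε s • (gen⟪c, b⟫ (u s) * gen⟪b, d⟫ (u' s * x))),
    Finset.sum_comm (f := fun s a ↦ ε s • (gen⟪a, d⟫ (u s) * gen⟪c, a⟫ (x * u' s))),
    Finset.sum_comm (f := fun s a ↦ ε s • (gen⟪a, d⟫ (u s * x) * gen⟪c, a⟫ (u' s)))]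
  have h14 : ∀ b, ∑ s, ε s • (gen⟪c, b⟫ (x * u s) * gen⟪b, d⟫ (u' s)) =
      ∑ s, ε s • (gen⟪c, b⟫ (u s) * gen⟪b, d⟫ (u' s * x)) := fun b ↦
    hF ((LinearMap.mul ℝ (UGL ℂ 2)).compl₁₂ (gen⟪c, b⟫) (gen⟪b, d⟫)) x
  have h32 : ∀ a, ∑ s, ε s • (gen⟪a, d⟫ (u s) * gen⟪c, a⟫ (x * u' s)) =
      ∑ s, ε s • (gen⟪a, d⟫ (u s * x) * gen⟪c, a⟫ (u' s)) := fun a ↦ by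
    have := hF ((LinearMap.mul ℝ (UGL ℂ 2)).compl₁₂ (gen⟪a, d⟫) (gen⟪c, a⟫)) x
    simp only [LinearMap.compl₁₂_apply, LinearMap.mul_apply', mul_comm x] at this ⊢
    exact this.symm
  simp_rw [h14, h32, sub_self, add_zero]

/-- **Centrality of a pair Casimir element** under the twisted Frobenius identity. Knapp 2002, §V.4.
[cite: Knapp2002, §V.4] -/
theorem pairCasimir_mem_center {S : Type*} [Fintype S] (u u' : S → ℂ) (ε : S → ℝ)
    (hF : ∀ (β : ℂ →ₗ[ℝ] ℂ →ₗ[ℝ] UGL ℂ 2) (x : ℂ),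
      ∑ s, ε s • β (x * u s) (u' s) = ∑ s, ε s • β (u s) (u' s * x)) :
    pairCasimir⟪u, u', ε⟫ ∈ Subalgebra.center ℝ (UGL ℂ 2) := by
  refine Literature.Algebra.Lie.mem_center_of_forall_ι_comm fun Y ↦ ?_
  change ιU Y * _ = _ * ιU Y
  rw [ιU_eq_sum_gen Y, Finset.sum_mul, Finset.mul_sum]
  refine Finset.sum_congr rfl fun a _ ↦ ?_
  rw [Finset.sum_mul, Finset.mul_sum]
  refine Finset.sum_congr rfl fun b _ ↦ ?_
  exact gen_mul_pairCasimir u u' ε hF a b _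

/-- A real-linear map out of `ℂ` is determined by its values at `1` and `i`. [folklore] -/
theorem linearMap_ext_one_I {M : Type*} [AddCommGroup M] [Module ℝ M] {f g : ℂ →ₗ[ℝ] M}
    (h1 : f 1 = g 1) (hI : f Complex.I = g Complex.I) : f = g := by
  refine Complex.basisOneI.ext fun i ↦ ?_
  fin_cases i
  · simpa using h1
  · simpa using hI

/-- Notation (local): **the real Casimir element**
`casimirRe = ∑_{a,b} (ι(E_{ab}) ι(E_{ba}) - ι(iE_{ab}) ι(iE_{ba}))` of `U_ℝ(𝔤𝔩₂(ℂ))` (the Casimir element of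
the invariant form `Re tr(XY)`; in `U_ℂ = U(𝔤𝔩₂) ⊗ U(𝔤𝔩₂)` it is `2(C_id + C_conj)`; no new definition). -/
local notation "casimirRe" =>
  (∑ a : Fin 2, ∑ b : Fin 2, (ιU (Matrix.single a b (1 : ℂ)) * ιU (Matrix.single b a (1 : ℂ)) -
    ιU (Matrix.single a b Complex.I) * ιU (Matrix.single b a Complex.I)) : UGL ℂ 2)

/-- Notation (local): **the imaginary Casimir element**
`casimirIm = ∑_{a,b} (ι(iE_{ab}) ι(E_{ba}) + ι(E_{ab}) ι(iE_{ba}))` of `U_ℝ(𝔤𝔩₂(ℂ))` (the Casimir element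
of the invariant form `Im tr(XY)`; in `U_ℂ` it is `2i(C_id - C_conj)`; no new definition). -/
local notation "casimirIm" =>
  (∑ a : Fin 2, ∑ b : Fin 2, (ιU (Matrix.single a b Complex.I) * ιU (Matrix.single b a (1 : ℂ)) +
    ιU (Matrix.single a b (1 : ℂ)) * ιU (Matrix.single b a Complex.I)) : UGL ℂ 2)

/-- `casimirRe` is the pair Casimir element of `u = u' = (1, i)`, `ε = (1, -1)`. [folklore] -/
theorem casimirRe_eq : casimirRe = pairCasimir⟪![(1 : ℂ), Complex.I], ![(1 : ℂ), Complex.I], ![(1 : ℝ), -1]⟫ := by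
  simp only [Fin.sum_univ_two, Matrix.cons_val_zero, Matrix.cons_val_one, one_smul, neg_smul,
    Finset.sum_sub_distrib]
  abel

/-- `casimirIm` is the pair Casimir element of `u = (i, 1)`, `u' = (1, i)`, `ε = (1, 1)`. [folklore] -/
theorem casimirIm_eq : casimirIm = pairCasimir⟪![Complex.I, 1], ![(1 : ℂ), Complex.I], ![(1 : ℝ), 1]⟫ := by
  simp only [Fin.sum_univ_two, Matrix.cons_val_zero, Matrix.cons_val_one, one_smul, Finset.sum_add_distrib]

/-- **`casimirRe` is central.** The Frobenius identity `x ⊗ 1 - (xi) ⊗ i = 1 ⊗ x - i ⊗ (ix)` holds on the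
real basis `1, i`. Knapp 2002, §V.4. [cite: Knapp2002, §V.4] -/
theorem casimirRe_mem_center : casimirRe ∈ Subalgebra.center ℝ (UGL ℂ 2) := by
  rw [casimirRe_eq]
  refine pairCasimir_mem_center _ _ _ fun β x ↦ ?_
  simp only [Fin.sum_univ_two, Matrix.cons_val_zero, Matrix.cons_val_one, one_smul, neg_smul, mul_one,
    one_mul]
  have key : ∀ y : ℂ, β y 1 + -β (y * Complex.I) Complex.I = β 1 y + -β Complex.I (Complex.I * y) := by
    intro y
    have h := LinearMap.congr_fun (linearMap_ext_one_I (M := UGL ℂ 2)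
      (f := β.flip 1 - (β.flip Complex.I).comp (LinearMap.mulRight ℝ Complex.I))
      (g := β 1 - (β Complex.I).comp (LinearMap.mulLeft ℝ Complex.I)) ?_ ?_) y
    · simpa [sub_eq_add_neg, mul_comm y] using h
    · simp
    · simp only [LinearMap.sub_apply, LinearMap.comp_apply, LinearMap.flip_apply, LinearMap.mulRight_apply,
        LinearMap.mulLeft_apply, Complex.I_mul_I, map_neg]
      abel
  exact key x

/-- **`casimirIm` is central.** The Frobenius identity `(xi) ⊗ 1 + x ⊗ i = i ⊗ x + 1 ⊗ (ix)` holds on the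
real basis `1, i`. Knapp 2002, §V.4. [cite: Knapp2002, §V.4] -/
theorem casimirIm_mem_center : casimirIm ∈ Subalgebra.center ℝ (UGL ℂ 2) := by
  rw [casimirIm_eq]
  refine pairCasimir_mem_center _ _ _ fun β x ↦ ?_
  simp only [Fin.sum_univ_two, Matrix.cons_val_zero, Matrix.cons_val_one, one_smul, mul_one, one_mul]
  have key : ∀ y : ℂ, β (y * Complex.I) 1 + β y Complex.I = β Complex.I y + β 1 (Complex.I * y) := by
    intro y
    have h := LinearMap.congr_fun (linearMap_ext_one_I (M := UGL ℂ 2)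
      (f := (β.flip 1).comp (LinearMap.mulRight ℝ Complex.I) + β.flip Complex.I)
      (g := β Complex.I + (β 1).comp (LinearMap.mulLeft ℝ Complex.I)) ?_ ?_) y
    · simpa [mul_comm y] using h
    · simp only [LinearMap.add_apply, LinearMap.comp_apply, LinearMap.flip_apply, LinearMap.mulRight_apply,
        LinearMap.mulLeft_apply, one_mul, mul_one]
    · simp only [LinearMap.add_apply, LinearMap.comp_apply, LinearMap.flip_apply, LinearMap.mulRight_apply,
        LinearMap.mulLeft_apply, Complex.I_mul_I, map_neg]
      abel
  exact key x

end GL2ComplexCasimir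

end Literature.NumberTheory.Automorphic

end
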